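import Literature.NumberTheory.GaloisRepresentations.LubinTateColemanUnitsImageTopologyTwo
import Literature.NumberTheory.GaloisRepresentations.LubinTateColemanRelativeGaloisActionLaws
import Literature.NumberTheory.GaloisRepresentations.AbsGaloisGroupCompact
import HarnessLib

/-!
# The image under `Col` of a CLOSED, GALOIS-STABLE subgroup of `𝒰¹_∞` is a closed `Λ`-submodule of `N` (de Shalit III.1.4:
# `i(𝒞̄) = μ(𝔣)Λ₀` computed on a closure); the Lubin–Tate character is ONTO on `Gal(F̄/E_∞)` (`q = 2`)

De Shalit, *Iwasawa theory of elliptic curves with complex multiplication* (1987), Ch. I §1.8 ("`k'(W_f)/k'` … its Galois group is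
isomorphic to `𝒪^×` via `κ`"), §3.4 Corollary, §3.7; Ch. III §1.4 ("`C̄_n` the closure of `C_n` … `𝒞_𝔣 = lim← ⟨C̄_n⟩` …
`i : 𝒞_𝔣 ⊗̂ 𝐃 ≃ μ(𝔣)Λ₀`"; Remark: "`𝒞_𝔣` may be described as the group generated by the `β(𝔞)`" — a CLOSED `Λ`-span).  With the
topology of `LubinTateColemanUnitsImageTopologyTwo` (`Col : 𝒰¹_∞ ≃ₜ N`, `N` closed, closed operator-stable subgroups are `Λ`-submodules) and
the equivariance of `LubinTateColemanUnitsImageGaloisTwo` (`Col(σ̃β) = galOpₗ (χσ̃) g s (Col β)`), THIS file proves (0 sorry):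

* §1 ★★ `exists_absGal_fixing_forall_lubinTateChar_eq` — **the Lubin–Tate character `χ_π` maps `{σ̃ ∈ Γ_F : σ̃ = id on every E_m}` ONTO
  `𝒪_F^×`** (finite levels `exists_absGal_fixing_ltAbsChar_eq` + compactness of `Γ_F`: Cantor intersection of the closed sets
  `{σ̃ : σ̃|E_N = id, χ(σ̃) ≡ v (π^{N+1})}`).
* §2 for a set `C` of families with `C ⊆ 𝒰¹_∞` closed, containing `1`, closed under products, inverses and the action of `Γ_F`:
  `colemanImageSubgroup C` — **`Col(C)` is an additive subgroup of `M`**, ★ closed (`isClosed_colemanImageSubgroup`), ★ stable under every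
  `σ_v` (`unitTwistₗ`, via §1) and under `C(1+X)• ∘ shift₁` (Frobenius composed with an inertia element killing its character);
  ★★★ `smul_mem_colemanImageSubgroup` / `colemanImageSubmodule` — for `d = 1` (no prime-to-`p` part: `Subsingleton (ZMod d)`) and `ℕ` dense in
  `𝒪_F` (`F` of degree one over `ℚ_p`), **`Col(C)` is a closed `Λ = 𝒪_F⟦X⟧⟦T⟧`-SUBMODULE of `N`** — the object `i(𝒞̄)` of III.1.4.

## References
* E. de Shalit, *Iwasawa theory of elliptic curves with complex multiplication* (1987), Ch. I §1.8, §3.4 Corollary, §3.7; Ch. III §1.4. [deShalit1987]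
* J. W. S. Cassels, A. Fröhlich (eds.), *Algebraic Number Theory* (1967), Ch. VI (Serre) §3.4 Thm. 3 (b), §3.6 Prop. 6 (b). [CasselsFrohlichANT1967]
* N. Bourbaki, *General Topology* Ch. I §9.1 (Cantor intersection in compact spaces). [BourbakiGT1]
-/

noncomputable section

open Filter Topology
open scoped PowerSeries.WithPiTopology

namespace Literature.NumberTheory.GaloisRepresentations

section UnitsImageGaloisTopologyTwo

open GaloisRepresentations.IsNonarchimedeanLocalField LubinTate ValuativeRel Field Finset

variable {F : Type} [Field F] [ValuativeRel F] [TopologicalSpace F] [IsNonarchimedeanLocalField F]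

attribute [local instance] ltNormUniformSpace ltNormIsUniformAddGroup rk1 nF nE fintypeResidueField

/-! ### §1. `χ_π` is onto on `Gal(F̄/E_∞)` -/

section Character

variable {π : 𝒪[F]} (hπ : (valuation F).IsUniformizer (π : F))

/-- In the compact ring `𝒪_F`, divisibility by a fixed element is a CLOSED condition (multiples of `a` = image of `· * a`).
[cite: BourbakiGT1, Ch. I §9.4 Cor. 2] -/
theorem isClosed_setOf_dvd_integer (a : 𝒪[F]) : IsClosed {x : 𝒪[F] | a ∣ x} := by
  have e : {x : 𝒪[F] | a ∣ x} = Set.range fun s : 𝒪[F] => a * s := by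
    ext x; exact ⟨fun ⟨s, hs⟩ => ⟨s, hs.symm⟩, fun ⟨s, hs⟩ => ⟨s, hs.symm⟩⟩
  rw [e]
  exact (isCompact_range (continuous_const.mul continuous_id)).isClosed

omit [ValuativeRel F] [TopologicalSpace F] [IsNonarchimedeanLocalField F] in
/-- The elements of `Γ_F` fixing a given `x ∈ F̄` form a CLOSED (indeed open) subset. [cite: CasselsFrohlichANT1967, Ch. VI §3.6] -/
theorem isClosed_setOf_smul_eq (x : AlgebraicClosure F) : IsClosed {σ : absoluteGaloisGroup F | σ • x = x} := by
  have hopen : IsOpen ((MulAction.stabilizer (absoluteGaloisGroup F) x : Subgroup (absoluteGaloisGroup F)) : Set (absoluteGaloisGroup F)) :=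
    stabilizer_isOpen_of_isIntegral x
  have hcl := (MulAction.stabilizer (absoluteGaloisGroup F) x).isClosed_of_isOpen hopen
  have e : {σ : absoluteGaloisGroup F | σ • x = x} = (MulAction.stabilizer (absoluteGaloisGroup F) x : Set (absoluteGaloisGroup F)) := by
    ext σ; rfl
  rwa [e]

variable (E : ℕ → IntermediateField F (AlgebraicClosure F)) [∀ m, FiniteDimensional F (E m)] (hmono : Monotone E)
  (hE : ∀ m, E m ≤ maxUnramified F)

include hmono hE in
/-- ★★ **The Lubin–Tate character is ONTO `𝒪_F^×` on the subgroup of `Γ_F` fixing the whole unramified tower `E_∞ = ⋃ E_m`**: for every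
`v ∈ 𝒪_F^×` there is `σ̃ ∈ Γ_F` with `σ̃ = id` on every `E_m` and `χ_π(σ̃) = v` (finite levels: `exists_absGal_fixing_ltAbsChar_eq`; limit: Cantor's
intersection theorem in the compact `Γ_F`). [cite: deShalit1987, Ch. I §1.8] [cite: CasselsFrohlichANT1967, Ch. VI §3.4 Thm. 3 (b), §3.6 Prop. 6 (b)] -/
theorem exists_absGal_fixing_forall_lubinTateChar_eq (v : 𝒪[F]ˣ) :
    ∃ σ : absoluteGaloisGroup F, (∀ m (x : E m), σ • (x : AlgebraicClosure F) = x) ∧ lubinTateChar hπ σ = v := by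
  haveI : CompactSpace (absoluteGaloisGroup F) := absoluteGaloisGroup_compactSpace F
  -- the closed sets `S_N = {σ | σ|E_N = id, π^{N+1} ∣ χ σ − v}`
  let S : ℕ → Set (absoluteGaloisGroup F) := fun N =>
    {σ | (∀ x : E N, σ • (x : AlgebraicClosure F) = x) ∧ π ^ (N + 1) ∣ (lubinTateChar hπ σ : 𝒪[F]) - v}
  have hcl : ∀ N, IsClosed (S N) := by
    intro N
    have e : S N = (⋂ x : E N, {σ : absoluteGaloisGroup F | σ • (x : AlgebraicClosure F) = x}) ∩
        (fun σ => (lubinTateChar hπ σ : 𝒪[F]) - v) ⁻¹' {y : 𝒪[F] | π ^ (N + 1) ∣ y} := by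
      ext σ; simp only [S, Set.mem_setOf_eq, Set.mem_inter_iff, Set.mem_iInter, Set.mem_preimage]
    rw [e]
    refine IsClosed.inter (isClosed_iInter fun x : E N => isClosed_setOf_smul_eq (F := F) (x : AlgebraicClosure F)) ?_
    refine IsClosed.preimage (f := fun σ : absoluteGaloisGroup F => (lubinTateChar hπ σ : 𝒪[F]) - (v : 𝒪[F])) ?_
      (isClosed_setOf_dvd_integer (π ^ (N + 1)))
    exact (continuous_val_lubinTateChar hπ).sub continuous_const
  have hne : ∀ N, (S N).Nonempty := by
    intro N
    obtain ⟨σ, hσE, hσ⟩ := exists_absGal_fixing_ltAbsChar_eq hπ (E N) (hE N) N v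
    refine ⟨σ, hσE, ?_⟩
    rw [← unitsModPow_eq_iff, unitsModPow_lubinTateChar]
    exact Units.ext hσ
  have hanti : ∀ N, S (N + 1) ⊆ S N := by
    rintro N σ ⟨h1, h2⟩
    refine ⟨fun x => ?_, ?_⟩
    · have hx := h1 ⟨(x : AlgebraicClosure F), hmono (Nat.le_succ N) x.2⟩
      exact hx
    · exact (pow_dvd_pow π (Nat.le_succ (N + 1))).trans h2
  obtain ⟨σ, hσ⟩ := IsCompact.nonempty_iInter_of_sequence_nonempty_isCompact_isClosed S hanti hne (hcl 0).isCompact hcl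
  rw [Set.mem_iInter] at hσ
  refine ⟨σ, fun m x => (hσ m).1 x, ?_⟩
  exact Units.ext (eq_of_forall_pow_dvd_sub hπ fun n => (hσ n).2)

end Character

/-! ### §2. `Col` of a closed Galois-stable subgroup of `𝒰¹_∞` -/

section Image

variable {p : ℕ} [hp : Fact p.Prime] {d : ℕ} (hd : d.Coprime p)
variable {π : 𝒪[F]} (hπ : (valuation F).IsUniformizer (π : F))
variable (E : ℕ → IntermediateField F (AlgebraicClosure F)) [∀ m, FiniteDimensional F (E m)] [∀ m, Normal F (E m)]
  [∀ m, IsGalois F (E m)] (hmono : Monotone E) (hE : ∀ m, E m ≤ maxUnramified F) (hdeg : ∀ m, Module.finrank F (E m) = d * p ^ m)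
  {σ₀ : absoluteGaloisGroup F} (hσ₀ : IsAbsArithFrob σ₀) (hq : residueFieldCard F = 2)
variable (u : (LTCoeff F)ˣ) (hu : LTCoeff.of F π = residueFieldCard F * u) (γ : 𝒪[F]ˣ)
variable [NeZero d] [IsAdicComplete (Ideal.span {(p : 𝒪[F])}) 𝒪[F]]
variable {θ : ∀ m, unitBall (E m)} (hθ : ∀ m, IsIntegralNormalGen (E m) (θ m))
  (hcoh : ∀ m, unitBallTrace (hmono (Nat.le_succ m)) (θ (m + 1)) = θ m)

/-- `Col` does not depend on the coherence certificate (proof irrelevance, for rewriting families). [cite: deShalit1987, Ch. I §3.8 (17)] -/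
theorem colemanImage_congr {β β' : ∀ m, RelNormCoherentUnits hπ (E m)} (hβ : ∀ m, (β (m + 1)).baseNorm hπ (hmono (Nat.le_succ m)) = β m)
    (hβ' : ∀ m, (β' (m + 1)).baseNorm hπ (hmono (Nat.le_succ m)) = β' m) (h : β = β') :
    colemanImage hd hπ E hmono hE hdeg hσ₀ hq u hu γ hθ hcoh hβ = colemanImage hd hπ E hmono hE hdeg hσ₀ hq u hu γ hθ hcoh hβ' := by
  subst h; rfl

/-- The set of families under consideration: a subset `C` of `𝒰¹_∞ = principalCoherentFamilies`, read inside the subtype (plumbing).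
[cite: deShalit1987, Ch. III §1.4] -/
private def inSub (C : Set (∀ m, RelNormCoherentUnits hπ (E m))) : Set (principalCoherentFamilies hπ E hmono) := {β | β.1 ∈ C}

omit [∀ m, Normal F (E m)] in
/-- `inSub C` is closed when `C` is. [cite: BourbakiGT1, Ch. I §3.1] -/
private theorem isClosed_inSub {C : Set (∀ m, RelNormCoherentUnits hπ (E m))} (hC : IsClosed C) : IsClosed (inSub hπ E hmono C) :=
  hC.preimage continuous_subtype_val

/-- **`Col(C)`** — the image under the two-variable Coleman transform of a set `C ⊆ 𝒰¹_∞` of principal coherent families.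
[cite: deShalit1987, Ch. III §1.4] -/
def colemanImageSet (C : Set (∀ m, RelNormCoherentUnits hπ (E m))) : Set (ZMod d → ColemanCoordModule hπ hq (intBase F) u hu γ) :=
  (fun β : principalCoherentFamilies hπ E hmono => colemanImage hd hπ E hmono hE hdeg hσ₀ hq u hu γ hθ hcoh β.2.1) '' inSub hπ E hmono C

/-- Membership in `Col(C)`. [cite: deShalit1987, Ch. III §1.4] -/
theorem mem_colemanImageSet_iff {C : Set (∀ m, RelNormCoherentUnits hπ (E m))} {G : ZMod d → ColemanCoordModule hπ hq (intBase F) u hu γ} :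
    G ∈ colemanImageSet hd hπ E hmono hE hdeg hσ₀ hq u hu γ hθ hcoh C ↔
      ∃ (β : ∀ m, RelNormCoherentUnits hπ (E m)) (hβ : β ∈ principalCoherentFamilies hπ E hmono), β ∈ C ∧
        colemanImage hd hπ E hmono hE hdeg hσ₀ hq u hu γ hθ hcoh hβ.1 = G := by
  constructor
  · rintro ⟨β, hβC, rfl⟩
    exact ⟨β.1, β.2, hβC, rfl⟩
  · rintro ⟨β, hβ, hβC, rfl⟩
    exact ⟨⟨β, hβ⟩, hβC, rfl⟩

include hdeg in
/-- `Col β ∈ Col(C)` for `β ∈ C`. [cite: deShalit1987, Ch. III §1.4] -/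
theorem colemanImage_mem_colemanImageSet {C : Set (∀ m, RelNormCoherentUnits hπ (E m))} {β : ∀ m, RelNormCoherentUnits hπ (E m)}
    (hβ : β ∈ principalCoherentFamilies hπ E hmono) (hβC : β ∈ C) :
    colemanImage hd hπ E hmono hE hdeg hσ₀ hq u hu γ hθ hcoh hβ.1 ∈ colemanImageSet hd hπ E hmono hE hdeg hσ₀ hq u hu γ hθ hcoh C :=
  (mem_colemanImageSet_iff hd hπ E hmono hE hdeg hσ₀ hq u hu γ hθ hcoh).mpr ⟨β, hβ, hβC, rfl⟩

include hdeg in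
/-- ★ **`Col(C)` is CLOSED for closed `C`** (`Col` is a closed map on the compact `𝒰¹_∞`). [cite: deShalit1987, Ch. III §1.4] -/
theorem isClosed_colemanImageSet {C : Set (∀ m, RelNormCoherentUnits hπ (E m))} (hC : IsClosed C) :
    IsClosed (colemanImageSet hd hπ E hmono hE hdeg hσ₀ hq u hu γ hθ hcoh C) :=
  isClosed_image_colemanImage hd hπ E hmono hE hdeg hσ₀ hq u hu γ hθ hcoh (isClosed_inSub hπ E hmono hC)

omit [∀ m, Normal F (E m)] in
/-- The inverse family `β⁻¹ = (β_m⁻¹)_m` of a principal coherent family is principal coherent. [cite: deShalit1987, Ch. I §3.8 (16)] -/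
theorem inv_mem_principalCoherentFamilies {β : ∀ m, RelNormCoherentUnits hπ (E m)} (hβ : β ∈ principalCoherentFamilies hπ E hmono) :
    (fun m => (β m).inv hπ (E m)) ∈ principalCoherentFamilies hπ E hmono := by
  refine ⟨fun m => ?_, fun m => ?_⟩
  · -- `N(β⁻¹) = (Nβ)⁻¹`: both are inverse to `Nβ_{m+1} = β_m`
    have hmul : ((β (m + 1)).mul ((β (m + 1)).inv hπ (E (m + 1)))).baseNorm hπ (hmono (Nat.le_succ m)) =
        (β m).mul ((β m).inv hπ (E m)) := by
      rw [RelNormCoherentUnits.mul_inv, RelNormCoherentUnits.mul_inv, RelNormCoherentUnits.baseNorm_one]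
    rw [RelNormCoherentUnits.baseNorm_mul, hβ.1 m] at hmul
    -- cancel `β m`
    refine RelNormCoherentUnits.ext fun n => Subtype.ext ?_
    have h := congrArg (fun δ : RelNormCoherentUnits hπ (E m) => ((δ.val n : unitBall (E m ⊔ ltField π n : IntermediateField F (AlgebraicClosure F))) :
      (E m ⊔ ltField π n : IntermediateField F (AlgebraicClosure F)))) hmul
    simp only [RelNormCoherentUnits.val_mul, Subring.coe_mul] at h
    exact mul_left_cancel₀ ((β m).coe_val_ne_zero hπ (E m) n) h
  · have h1 := hβ.2 m
    rw [RelNormCoherentUnits.coe_val_inv]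
    set x := (((β m).val 0 : unitBall (E m ⊔ ltField π 0 : IntermediateField F (AlgebraicClosure F))) :
      (E m ⊔ ltField π 0 : IntermediateField F (AlgebraicClosure F))) with hx
    have hx1 : ‖x‖ = 1 := (β m).norm_eq_one 0
    have hx0 : x ≠ 0 := (β m).coe_val_ne_zero hπ (E m) 0
    calc ‖x⁻¹ - 1‖ = ‖x⁻¹ * (1 - x)‖ := by rw [mul_sub, mul_one, inv_mul_cancel₀ hx0]
      _ = ‖1 - x‖ := by rw [norm_mul, norm_inv, hx1, inv_one, one_mul]
      _ = ‖x - 1‖ := by rw [← norm_neg, neg_sub]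
      _ < 1 := h1

include hdeg in
/-- `Col(β⁻¹) = −Col β`. [cite: deShalit1987, Ch. I §3.4 Lemma (i)] -/
theorem colemanImage_inv {β : ∀ m, RelNormCoherentUnits hπ (E m)} (hβ : β ∈ principalCoherentFamilies hπ E hmono) :
    colemanImage hd hπ E hmono hE hdeg hσ₀ hq u hu γ hθ hcoh (β := fun m => (β m).inv hπ (E m))
        (inv_mem_principalCoherentFamilies hπ E hmono hβ).1 =
      -colemanImage hd hπ E hmono hE hdeg hσ₀ hq u hu γ hθ hcoh (β := β) hβ.1 := by
  have hinv := inv_mem_principalCoherentFamilies hπ E hmono hβ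
  have hprod : ∀ m, ((β (m + 1)).mul ((β (m + 1)).inv hπ (E (m + 1)))).baseNorm hπ (hmono (Nat.le_succ m)) = (β m).mul ((β m).inv hπ (E m)) :=
    baseNormCoherent_mul hπ E hmono (β := β) (β' := fun m => (β m).inv hπ (E m)) hβ.1 hinv.1
  have hsum := colemanImage_mul hd hπ E hmono hE hdeg hσ₀ hq u hu γ hθ hcoh (β := β) (β' := fun m => (β m).inv hπ (E m)) hβ.1 hinv.1 hprod
  have hone : colemanImage hd hπ E hmono hE hdeg hσ₀ hq u hu γ hθ hcoh (β := fun m => (β m).mul ((β m).inv hπ (E m))) hprod = 0 := by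
    rw [colemanImage_congr hd hπ E hmono hE hdeg hσ₀ hq u hu γ hθ hcoh hprod (baseNormCoherent_one hπ E hmono)
      (funext fun m => RelNormCoherentUnits.mul_inv hπ (E m) (β m))]
    exact colemanImage_one hd hπ E hmono hE hdeg hσ₀ hq u hu γ hθ hcoh
  rw [hone] at hsum
  exact eq_neg_of_add_eq_zero_right hsum.symm

include hdeg in
/-- ★ **`Col(C)` is an ADDITIVE SUBGROUP of `M`** when `C ∋ 1` is closed under products and inverses (`Col` is a homomorphism:
`colemanImage_mul`, `colemanImage_one`, `colemanImage_inv`). [cite: deShalit1987, Ch. I §3.4 Lemma (i); Ch. III §1.4] -/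
def colemanImageSubgroup (C : Set (∀ m, RelNormCoherentUnits hπ (E m))) (hCsub : C ⊆ principalCoherentFamilies hπ E hmono)
    (h1 : (fun m => (RelNormCoherentUnits.one : RelNormCoherentUnits hπ (E m))) ∈ C)
    (hmul : ∀ β ∈ C, ∀ β' ∈ C, (fun m => (β m).mul (β' m)) ∈ C) (hinv : ∀ β ∈ C, (fun m => (β m).inv hπ (E m)) ∈ C) :
    AddSubgroup (ZMod d → ColemanCoordModule hπ hq (intBase F) u hu γ) where
  carrier := colemanImageSet hd hπ E hmono hE hdeg hσ₀ hq u hu γ hθ hcoh C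
  zero_mem' := (mem_colemanImageSet_iff hd hπ E hmono hE hdeg hσ₀ hq u hu γ hθ hcoh).mpr
    ⟨_, hCsub h1, h1, colemanImage_one hd hπ E hmono hE hdeg hσ₀ hq u hu γ hθ hcoh⟩
  add_mem' := by
    rintro G G' hG hG'
    obtain ⟨β, hβ, hβC, rfl⟩ := (mem_colemanImageSet_iff hd hπ E hmono hE hdeg hσ₀ hq u hu γ hθ hcoh).mp hG
    obtain ⟨β', hβ', hβ'C, rfl⟩ := (mem_colemanImageSet_iff hd hπ E hmono hE hdeg hσ₀ hq u hu γ hθ hcoh).mp hG'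
    refine (mem_colemanImageSet_iff hd hπ E hmono hE hdeg hσ₀ hq u hu γ hθ hcoh).mpr ⟨_, hCsub (hmul β hβC β' hβ'C), hmul β hβC β' hβ'C, ?_⟩
    rw [← colemanImage_mul hd hπ E hmono hE hdeg hσ₀ hq u hu γ hθ hcoh hβ.1 hβ'.1 (hCsub (hmul β hβC β' hβ'C)).1]
  neg_mem' := by
    rintro G hG
    obtain ⟨β, hβ, hβC, rfl⟩ := (mem_colemanImageSet_iff hd hπ E hmono hE hdeg hσ₀ hq u hu γ hθ hcoh).mp hG
    exact (mem_colemanImageSet_iff hd hπ E hmono hE hdeg hσ₀ hq u hu γ hθ hcoh).mpr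
      ⟨fun m => (β m).inv hπ (E m), inv_mem_principalCoherentFamilies hπ E hmono hβ, hinv β hβC,
        colemanImage_inv hd hπ E hmono hE hdeg hσ₀ hq u hu γ hθ hcoh hβ⟩

include hdeg in
/-- The carrier of `colemanImageSubgroup` is `Col(C)`. [cite: deShalit1987, Ch. III §1.4] -/
@[simp] theorem coe_colemanImageSubgroup (C : Set (∀ m, RelNormCoherentUnits hπ (E m))) (hCsub : C ⊆ principalCoherentFamilies hπ E hmono)
    (h1 : (fun m => (RelNormCoherentUnits.one : RelNormCoherentUnits hπ (E m))) ∈ C)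
    (hmul : ∀ β ∈ C, ∀ β' ∈ C, (fun m => (β m).mul (β' m)) ∈ C) (hinv : ∀ β ∈ C, (fun m => (β m).inv hπ (E m)) ∈ C) :
    (colemanImageSubgroup hd hπ E hmono hE hdeg hσ₀ hq u hu γ hθ hcoh C hCsub h1 hmul hinv : Set _) =
      colemanImageSet hd hπ E hmono hE hdeg hσ₀ hq u hu γ hθ hcoh C := rfl

/-- The Galois action preserves principal coherent families. [cite: deShalit1987, Ch. I §2.3 (iv), §3.8 (16)] -/
theorem galAct_mem_principalCoherentFamilies {β : ∀ m, RelNormCoherentUnits hπ (E m)} (hβ : β ∈ principalCoherentFamilies hπ E hmono)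
    (σ : absoluteGaloisGroup F) : (fun m => (β m).galAct σ) ∈ principalCoherentFamilies hπ E hmono :=
  ⟨galAct_baseNormCoherent hπ E hmono σ (β := β) hβ.1, galAct_principal hπ E σ (β := β) hβ.2⟩

variable [IsAdicComplete (Ideal.span {intBase F (LTCoeff.of F π)}) (PowerSeries 𝒪[F])]

include hdeg hE hmono in
/-- ★ **`Col(C)` is stable under every unit twist `σ_v`** when `C` is `Γ_F`-stable: pick `σ̃ ∈ Γ_F` fixing `E_∞` with `χ(σ̃) = v` (§1); then
`Col(σ̃β) = σ_v(Col β)`. [cite: deShalit1987, Ch. I §3.4 Lemma (ii); Ch. III §1.4] -/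
theorem unitTwistₗ_mem_colemanImageSet {C : Set (∀ m, RelNormCoherentUnits hπ (E m))}
    (hgal : ∀ σ : absoluteGaloisGroup F, ∀ β ∈ C, (fun m => (β m).galAct σ) ∈ C) (v : 𝒪[F]ˣ)
    {G : ZMod d → ColemanCoordModule hπ hq (intBase F) u hu γ} (hG : G ∈ colemanImageSet hd hπ E hmono hE hdeg hσ₀ hq u hu γ hθ hcoh C) :
    (fun j => unitTwistₗ hπ hq (intBase F) u hu γ v (G j)) ∈ colemanImageSet hd hπ E hmono hE hdeg hσ₀ hq u hu γ hθ hcoh C := by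
  obtain ⟨β, hβ, hβC, rfl⟩ := (mem_colemanImageSet_iff hd hπ E hmono hE hdeg hσ₀ hq u hu γ hθ hcoh).mp hG
  obtain ⟨σ, hσE, hσv⟩ := exists_absGal_fixing_forall_lubinTateChar_eq hπ E hmono hE v
  refine (mem_colemanImageSet_iff hd hπ E hmono hE hdeg hσ₀ hq u hu γ hθ hcoh).mpr
    ⟨fun m => (β m).galAct σ, galAct_mem_principalCoherentFamilies hπ E hmono hβ σ, hgal σ β hβC, ?_⟩
  rw [colemanImage_congr hd hπ E hmono hE hdeg hσ₀ hq u hu γ hθ hcoh (β := fun m => (β m).galAct σ) _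
      (galAct_baseNormCoherent hπ E hmono σ (β := β) hβ.1) rfl,
    colemanImage_galAct_of_forall_smul_eq hd hπ E hmono hE hdeg hσ₀ hq u hu γ hθ hcoh (β := β) hβ.1 hσE, hσv]
  rfl

include hdeg hE hmono in
/-- ★ **`Col(C)` is stable under `C(1+X)• ∘ shift₁`** (the Frobenius `σ₀` followed by an inertia element of character `χ(σ₀)⁻¹`).
[cite: deShalit1987, Ch. I §3.1, §3.8 (17); Ch. III §1.4] -/
theorem C_one_add_X_smul_indexShiftₗ_mem_colemanImageSet {C : Set (∀ m, RelNormCoherentUnits hπ (E m))}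
    (hgal : ∀ σ : absoluteGaloisGroup F, ∀ β ∈ C, (fun m => (β m).galAct σ) ∈ C)
    {G : ZMod d → ColemanCoordModule hπ hq (intBase F) u hu γ} (hG : G ∈ colemanImageSet hd hπ E hmono hE hdeg hσ₀ hq u hu γ hθ hcoh C) :
    (PowerSeries.C (1 + PowerSeries.X) : PowerSeries (PowerSeries 𝒪[F])) • indexShiftₗ hπ hq u hu γ 1 G ∈
      colemanImageSet hd hπ E hmono hE hdeg hσ₀ hq u hu γ hθ hcoh C := by
  obtain ⟨β, hβ, hβC, rfl⟩ := (mem_colemanImageSet_iff hd hπ E hmono hE hdeg hσ₀ hq u hu γ hθ hcoh).mp hG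
  -- Frobenius step, then an inertia element killing `χ(σ₀)`
  have hβ₀ : (fun m => (β m).galAct σ₀) ∈ principalCoherentFamilies hπ E hmono := galAct_mem_principalCoherentFamilies hπ E hmono hβ σ₀
  obtain ⟨τ, hτE, hτv⟩ := exists_absGal_fixing_forall_lubinTateChar_eq hπ E hmono hE (lubinTateChar hπ σ₀)⁻¹
  have hβ₁ : (fun m => ((β m).galAct σ₀).galAct τ) ∈ principalCoherentFamilies hπ E hmono :=
    galAct_mem_principalCoherentFamilies hπ E hmono hβ₀ τ
  have hC₁ : (fun m => ((β m).galAct σ₀).galAct τ) ∈ C := hgal τ _ (hgal σ₀ β hβC)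
  have e1 : colemanImage hd hπ E hmono hE hdeg hσ₀ hq u hu γ hθ hcoh (β := fun m => ((β m).galAct σ₀).galAct τ) hβ₁.1 =
      (unitTwistₗ hπ hq (intBase F) u hu γ (lubinTateChar hπ τ)).compLeft (ZMod d)
        (colemanImage hd hπ E hmono hE hdeg hσ₀ hq u hu γ hθ hcoh (β := fun m => (β m).galAct σ₀) hβ₀.1) := by
    rw [colemanImage_congr hd hπ E hmono hE hdeg hσ₀ hq u hu γ hθ hcoh (β := fun m => ((β m).galAct σ₀).galAct τ) hβ₁.1
      (galAct_baseNormCoherent hπ E hmono τ (β := fun m => (β m).galAct σ₀) hβ₀.1) rfl]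
    exact colemanImage_galAct_of_forall_smul_eq hd hπ E hmono hE hdeg hσ₀ hq u hu γ hθ hcoh (β := fun m => (β m).galAct σ₀) hβ₀.1 hτE
  have e2 : colemanImage hd hπ E hmono hE hdeg hσ₀ hq u hu γ hθ hcoh (β := fun m => (β m).galAct σ₀) hβ₀.1 =
      galOpₗ hπ hq u hu γ (lubinTateChar hπ σ₀) (1 + PowerSeries.X) 1 (colemanImage hd hπ E hmono hE hdeg hσ₀ hq u hu γ hθ hcoh (β := β) hβ.1) := by
    rw [colemanImage_congr hd hπ E hmono hE hdeg hσ₀ hq u hu γ hθ hcoh (β := fun m => (β m).galAct σ₀) hβ₀.1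
      (galAct_baseNormCoherent hπ E hmono σ₀ (β := β) hβ.1) rfl]
    exact colemanImage_galAct_frob hd hπ E hmono hE hdeg hσ₀ hq u hu γ hθ hcoh (β := β) hβ.1
  refine (mem_colemanImageSet_iff hd hπ E hmono hE hdeg hσ₀ hq u hu γ hθ hcoh).mpr ⟨_, hβ₁, hC₁, ?_⟩
  rw [e1, e2, hτv]
  funext j
  rw [LinearMap.compLeft_apply, Function.comp_apply, galOpₗ_apply, ← LinearMap.comp_apply, ← unitTwistₗ_mul, inv_mul_cancel, unitTwistₗ_one,
    LinearMap.id_apply, Pi.smul_apply, indexShiftₗ_apply]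

include hdeg hE hmono in
/-- ★★★ **`Col(C)` is a `Λ = 𝒪_F⟦X⟧⟦T⟧`-SUBMODULE** for a closed, `Γ_F`-stable subgroup `C ⊆ 𝒰¹_∞`, when the unramified tower has no
prime-to-`p` part (`d = 1`, i.e. `Subsingleton (ZMod d)`) and `ℕ` is dense in `𝒪_F` (`F` of degree one): `Col(C)` is closed, stable under
`σ_γ = (1+T)•` and under `C(1+X)•`, hence (`smul_mem_of_isClosed_of_ops`) under all of `Λ`.  De Shalit III.1.4: the image of the CLOSURE of the
elliptic units is a (closed) `Λ`-submodule. [cite: deShalit1987, Ch. III §1.4] [cite: Washington1997, §13.2] -/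
theorem smul_mem_colemanImageSet [Subsingleton (ZMod d)] (hN : DenseRange (Nat.cast : ℕ → 𝒪[F]))
    {C : Set (∀ m, RelNormCoherentUnits hπ (E m))} (hC : IsClosed C) (hCsub : C ⊆ principalCoherentFamilies hπ E hmono)
    (h1 : (fun m => (RelNormCoherentUnits.one : RelNormCoherentUnits hπ (E m))) ∈ C)
    (hmul : ∀ β ∈ C, ∀ β' ∈ C, (fun m => (β m).mul (β' m)) ∈ C) (hinv : ∀ β ∈ C, (fun m => (β m).inv hπ (E m)) ∈ C)
    (hgal : ∀ σ : absoluteGaloisGroup F, ∀ β ∈ C, (fun m => (β m).galAct σ) ∈ C)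
    (c : PowerSeries (PowerSeries 𝒪[F])) {G : ZMod d → ColemanCoordModule hπ hq (intBase F) u hu γ}
    (hG : G ∈ colemanImageSet hd hπ E hmono hE hdeg hσ₀ hq u hu γ hθ hcoh C) :
    c • G ∈ colemanImageSet hd hπ E hmono hE hdeg hσ₀ hq u hu γ hθ hcoh C := by
  have h := smul_mem_of_isClosed_of_ops hπ hq u hu γ hN (Z := colemanImageSubgroup hd hπ E hmono hE hdeg hσ₀ hq u hu γ hθ hcoh C hCsub h1 hmul hinv)
    (isClosed_colemanImageSet hd hπ E hmono hE hdeg hσ₀ hq u hu γ hθ hcoh hC)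
    (fun G hG => unitTwistₗ_mem_colemanImageSet hd hπ E hmono hE hdeg hσ₀ hq u hu γ hθ hcoh hgal γ hG)
    (fun G hG => by
      have h' := C_one_add_X_smul_indexShiftₗ_mem_colemanImageSet hd hπ E hmono hE hdeg hσ₀ hq u hu γ hθ hcoh hgal hG
      have e : indexShiftₗ hπ hq u hu γ 1 G = G := funext fun j => by rw [indexShiftₗ_apply, Subsingleton.elim (j - 1) j]
      rwa [e] at h') c hG
  exact h

include hdeg hE hmono in
/-- ★★★ **`Col(C)` as a `Λ`-submodule of `M`** (hypotheses of `smul_mem_colemanImageSet`). [cite: deShalit1987, Ch. III §1.4] -/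
def colemanImageSubmodule [Subsingleton (ZMod d)] (hN : DenseRange (Nat.cast : ℕ → 𝒪[F]))
    (C : Set (∀ m, RelNormCoherentUnits hπ (E m))) (hC : IsClosed C) (hCsub : C ⊆ principalCoherentFamilies hπ E hmono)
    (h1 : (fun m => (RelNormCoherentUnits.one : RelNormCoherentUnits hπ (E m))) ∈ C)
    (hmul : ∀ β ∈ C, ∀ β' ∈ C, (fun m => (β m).mul (β' m)) ∈ C) (hinv : ∀ β ∈ C, (fun m => (β m).inv hπ (E m)) ∈ C)
    (hgal : ∀ σ : absoluteGaloisGroup F, ∀ β ∈ C, (fun m => (β m).galAct σ) ∈ C) :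
    Submodule (PowerSeries (PowerSeries 𝒪[F])) (ZMod d → ColemanCoordModule hπ hq (intBase F) u hu γ) where
  carrier := colemanImageSet hd hπ E hmono hE hdeg hσ₀ hq u hu γ hθ hcoh C
  add_mem' := (colemanImageSubgroup hd hπ E hmono hE hdeg hσ₀ hq u hu γ hθ hcoh C hCsub h1 hmul hinv).add_mem
  zero_mem' := (colemanImageSubgroup hd hπ E hmono hE hdeg hσ₀ hq u hu γ hθ hcoh C hCsub h1 hmul hinv).zero_mem
  smul_mem' c _ hG := smul_mem_colemanImageSet hd hπ E hmono hE hdeg hσ₀ hq u hu γ hθ hcoh hN hC hCsub h1 hmul hinv hgal c hG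

include hdeg hE hmono in
/-- The carrier of `colemanImageSubmodule` is `Col(C)`. [cite: deShalit1987, Ch. III §1.4] -/
@[simp] theorem mem_colemanImageSubmodule [Subsingleton (ZMod d)] {hN : DenseRange (Nat.cast : ℕ → 𝒪[F])}
    {C : Set (∀ m, RelNormCoherentUnits hπ (E m))} {hC : IsClosed C} {hCsub : C ⊆ principalCoherentFamilies hπ E hmono}
    {h1 : (fun m => (RelNormCoherentUnits.one : RelNormCoherentUnits hπ (E m))) ∈ C}
    {hmul : ∀ β ∈ C, ∀ β' ∈ C, (fun m => (β m).mul (β' m)) ∈ C} {hinv : ∀ β ∈ C, (fun m => (β m).inv hπ (E m)) ∈ C}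
    {hgal : ∀ σ : absoluteGaloisGroup F, ∀ β ∈ C, (fun m => (β m).galAct σ) ∈ C} {G : ZMod d → ColemanCoordModule hπ hq (intBase F) u hu γ} :
    G ∈ colemanImageSubmodule hd hπ E hmono hE hdeg hσ₀ hq u hu γ hθ hcoh hN C hC hCsub h1 hmul hinv hgal ↔
      G ∈ colemanImageSet hd hπ E hmono hE hdeg hσ₀ hq u hu γ hθ hcoh C := Iff.rfl

include hdeg in
/-- `Col(C) ≤ N`: the image lies in `unitsImage`. [cite: deShalit1987, Ch. III §1.3–1.4] -/
theorem colemanImageSet_subset_unitsImage [CharZero F] (hI : Ideal.span {(p : 𝒪[F])} ≠ ⊤) (hud : ∀ m, (u : LTCoeff F) ^ Module.finrank F (E m) ≠ 1)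
    (hm : ∃ m₁ : ℕ, LTCoeff.of F π ^ 2 ∣ LTCoeff.of F π - m₁) (C : Set (∀ m, RelNormCoherentUnits hπ (E m))) :
    colemanImageSet hd hπ E hmono hE hdeg hσ₀ hq u hu γ hθ hcoh C ⊆ (unitsImage hd hπ E hmono hE hdeg hσ₀ hq u hu γ hθ hcoh hI hud : Set _) := by
  rintro _ ⟨β, -, rfl⟩
  exact colemanImage_mem_unitsImage hd hπ E hmono hE hdeg hσ₀ hq u hu γ hθ hcoh hI hud hm β.2.1 β.2.2

end Image

end UnitsImageGaloisTopologyTwo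

end Literature.NumberTheory.GaloisRepresentations
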